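import Summits.AnomalousDissipation.AnomalousDissipation.Theorems.SolenoidalFractalHomogenisationLagrangianStepVmodConstMode
import Summits.AnomalousDissipation.AnomalousDissipation.Theorems.SolenoidalFractalHomogenisationLagrangianStepPropagatorClass
import Literature.Analysis.FluidPDE.PassiveVectorTensorOffBallDecay
import HarnessLib

/-!
# K1L_D (stmt-AnomalousDissipation-27980): (V_mod) flat stage, block (ff) — the REST: fast data off every slow class pair decay under the cell member
# (prover ad-k3l-bookkeeping-p1 g10; RULING D28-9 / D28-17 (a) assign the (ff) grid twin to the k3l lineage; helper `--supports 27980 --as helper`)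

The rest piece `x_r` of the (ff) assembly (`…VmodFfAssembly`) is weakly divergence-free, vanishes on the slow ball `freqBall(n/4)` and on every
class pair `±ℓ + nℤ³` of a nonzero slow label.  Along the cell member its ORBIT keeps both properties (class preservation
`PropagatorSymm.fcoeff_apply_eq_zero_of_classes`; mean conservation `VmodFlat.fc_apply_zero_eq`), hence stays off the slow ball, and the energy
inequality off a Fourier ball gives exponential decay:
* `norm_sq_apply_le_exp_of_orbit_off_ball` — ABSTRACT (`Torus.IsPropagator T b 𝔸 U`, `NearIso 𝔸 lo hi`, bounded a.e.-divergence-free carrier):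
  if `U s r y` vanishes on `freqBall N₀` for every `r ∈ [s, T]`, then `‖U s t y‖² ≤ exp(−8π²·lo·N₀²·(t−s))·‖y‖²` (the proof of
  `IsPropagator.norm_sq_apply_le_exp_of_multiplier` with the support hypothesis read off the orbit through `IsPropagator.repr`);
* `orbit_off_ball_of_rest` — for the cell member: a divergence-free datum vanishing on `freqBall(n/4)` and on all class pairs of
  `freqBall(n/4) ∖ {0}` has its whole orbit vanishing on `freqBall(n/4)`;
* **`norm_apply_rest_le`** — `‖U s t w‖ ≤ exp(−(4π²·ν·(lo/Λ)·((n/4 : ℕ))²/n²)·(t−s))·‖w‖` for such `w`.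
`sorry`-free; NOT a proof of (ff), of the stub, of K1L_D or of AD; rung F-D1.A0.
-/

set_option linter.dupNamespace false

noncomputable section

namespace Summit.AnomalousDissipation.AnomalousDissipation.Theorems.SolenoidalFractalHomogenisation.LagrangianStep.VmodGen

open Set MeasureTheory Complex UnitAddTorus Filter Topology
open scoped InnerProductSpace ENNReal
open Literature.Analysis Literature.Analysis.FunctionSpaces Literature.Analysis.FunctionSpaces.Torus
open Literature.Analysis.FluidPDE Literature.Analysis.FluidPDE.Torus Literature.Analysis.FluidPDE.LatticeShear
open Summit.AnomalousDissipation.AnomalousDissipation.Theorems.SolenoidalFractalHomogenisation.LagrangianStep.VmodFlat (fc fc_apply_zero_eq)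
open Summit.AnomalousDissipation.AnomalousDissipation.Theorems.SolenoidalFractalHomogenisation.RealisedQuasiStaticCellLaw
  (isSmooth_cell isDivFree_cell memLp_top_stLift_cell)

/-! ## §1 Abstract: decay when the orbit stays off a Fourier ball -/

set_option maxHeartbeats 1600000 in
/-- **DECAY OF THE WINDOW PROPAGATOR ON A DATUM WHOSE ORBIT STAYS OFF A FOURIER BALL.**
[cite: Temam1984, Ch. III §1 Lemma 1.2] [cite: Pazy1983, Ch. 5 §5.1 Def. 5.3] -/
theorem norm_sq_apply_le_exp_of_orbit_off_ball {T : ℝ} {𝔸 : Visc4 (Fin 3)} {lo hi : ℝ} {b : ℝ → VF} {U : ℝ → ℝ → (V2 →L[ℝ] V2)}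
    (hU : IsPropagator T b 𝔸 U) (h𝔸 : NearIso 𝔸 lo hi) (hlo : 0 < lo)
    (hb : MemLp (FunctionSpaces.Torus.stLift b) ∞ (volume.restrict (Ioo 0 T ×ˢ univ)))
    (hbdiv : ∀ᵐ τ ∂(volume.restrict (Ioo 0 T)), FunctionSpaces.Torus.IsWeaklyDivFree (b τ))
    (N₀ : ℕ) (y : V2) (hy : y ∈ divFreeL2 (Fin 3)) {s t : ℝ} (hs : 0 ≤ s) (hst : s ≤ t) (htT : t ≤ T)
    (horbit : ∀ r, s ≤ r → r ≤ T → ∀ k ∈ FunctionSpaces.Torus.freqBall (d := Fin 3) N₀, fc (U s r y) k = 0) :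
    ‖U s t y‖ ^ 2 ≤ Real.exp (-(8 * Real.pi ^ 2 * lo * (N₀ : ℝ) ^ 2 * (t - s))) * ‖y‖ ^ 2 := by
  set κ : ℝ := 8 * Real.pi ^ 2 * lo * (N₀ : ℝ) ^ 2 with hκ
  rcases hst.eq_or_lt with heq | hst'
  · subst heq
    rw [sub_self, mul_zero, neg_zero, Real.exp_zero, one_mul]
    exact pow_le_pow_left₀ (norm_nonneg _) (hU.norm_le s s y) 2
  have hsT : s < T := hst'.trans_le htT
  -- the datum as a function and the chosen window solution
  set φ : UnitAddTorus (Fin 3) → EuclideanSpace ℝ (Fin 3) := (y : UnitAddTorus (Fin 3) → EuclideanSpace ℝ (Fin 3)) with hφdef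
  have hφ : MemLp φ 2 volume := Lp.memLp y
  have hφdiv : FunctionSpaces.Torus.IsWeaklyDivFree φ := (mem_divFreeL2_iff y).1 hy
  set w := windowSol h𝔸 hlo hb hbdiv hs hsT hφ hφdiv with hwdef
  have hw := windowSol_spec h𝔸 hlo hb hbdiv hs hsT hφ hφdiv
  have hbs := memLp_top_stLift_shift_window (T := T) (b := b) hb hs
  have hrepr := hU.repr s hs hsT φ hφ hφdiv w hw
  have hPy : hφ.toLp φ = y := Lp.toLp_coeFn y hφ
  -- the window solution stays off the ball (read off the orbit of `U`)
  have hoff : ∀ᵐ τ ∂(volume.restrict (Ioo 0 (T - s))), ∀ k ∈ FunctionSpaces.Torus.freqBall (d := Fin 3) N₀,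
      mFourierCoeff (FunctionSpaces.EuclideanSpace.complexify ∘ w τ) k = 0 := by
    filter_upwards [hrepr, ae_restrict_mem measurableSet_Ioo] with τ hτr hτI k hk
    obtain ⟨hτm, hτe⟩ := hτr
    have hae : (FunctionSpaces.EuclideanSpace.complexify ∘ w τ) =ᵐ[volume]
        (FunctionSpaces.EuclideanSpace.complexify ∘ ⇑(hτm.toLp (w τ))) :=
      (MemLp.coeFn_toLp hτm).symm.fun_comp FunctionSpaces.EuclideanSpace.complexify
    rw [FunctionSpaces.Torus.mFourierCoeff_congr_ae hae k, hτe, hPy]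
    exact horbit (s + τ) (by linarith [hτI.1]) (by linarith [hτI.2]) k hk
  have hdec := hw.ae_integral_norm_sq_le_exp_of_off_ball h𝔸 hlo hφ hφdiv hbs N₀ hoff
  have hφE : ∫ x, ‖φ x‖ ^ 2 = ‖y‖ ^ 2 := (norm_sq_eq_integral_norm_sq y).symm
  -- for a.e. window time: the decay of `U s (s+τ) y`
  have hae : ∀ᵐ τ ∂(volume.restrict (Ioo 0 (T - s))), ‖U s (s + τ) y‖ ^ 2 ≤ Real.exp (-(κ * τ)) * ‖y‖ ^ 2 := by
    filter_upwards [hdec, hrepr] with τ hτ hτr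
    obtain ⟨hτm, hτe⟩ := hτr
    have e1 : U s (s + τ) y = hτm.toLp (w τ) := by rw [hτe, hPy]
    have e2 : ‖hτm.toLp (w τ)‖ ^ 2 = ∫ x, ‖w τ x‖ ^ 2 := by
      rw [norm_sq_eq_integral_norm_sq]
      exact integral_congr_ae (by filter_upwards [MemLp.coeFn_toLp hτm] with x hx; rw [hx])
    calc ‖U s (s + τ) y‖ ^ 2 = ∫ x, ‖w τ x‖ ^ 2 := by rw [e1, e2]
      _ ≤ Real.exp (-(8 * Real.pi ^ 2 * lo * (N₀ : ℝ) ^ 2 * τ)) * ∫ x, ‖φ x‖ ^ 2 := hτ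
      _ = Real.exp (-(κ * τ)) * ‖y‖ ^ 2 := by rw [hφE, hκ]
  -- the endpoint `t`: monotonicity of the energy and density of the good window times below `t − s`
  by_contra hcon
  push Not at hcon
  have hcont : ContinuousAt (fun τ : ℝ => Real.exp (-(κ * τ)) * ‖y‖ ^ 2) (t - s) :=
    ((Real.continuous_exp.comp (continuous_const.mul continuous_id).neg).mul continuous_const).continuousAt
  have hev : ∀ᶠ τ in 𝓝 (t - s), Real.exp (-(κ * τ)) * ‖y‖ ^ 2 < ‖U s t y‖ ^ 2 := hcont.eventually (Iio_mem_nhds hcon)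
  obtain ⟨ε, hε, hεball⟩ := Metric.eventually_nhds_iff.1 hev
  set a : ℝ := max (t - s - ε / 2) ((t - s) / 2) with ha
  have hts : 0 < t - s := sub_pos.2 hst'
  have hab : a < t - s := max_lt (by linarith) (by linarith)
  have hsub : Ioo a (t - s) ⊆ Ioo 0 (T - s) := fun τ hτ =>
    ⟨lt_of_lt_of_le (by positivity : (0:ℝ) < (t - s) / 2) ((le_max_right _ _).trans hτ.1.le), hτ.2.trans_le (by linarith)⟩
  have hfalse : ∀ᵐ τ ∂(volume.restrict (Ioo a (t - s))), False := by
    filter_upwards [ae_restrict_of_ae_restrict_of_subset hsub hae, ae_restrict_mem measurableSet_Ioo] with τ hτ hτI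
    have h1 : ‖U s t y‖ ≤ ‖U s (s + τ) y‖ := hU.norm_apply_le_of_le hs (by linarith [hτI.1, (le_max_right _ _ : (t - s) / 2 ≤ a)])
      (by linarith [hτI.2]) htT y
    have h2 : dist τ (t - s) < ε := by
      rw [Real.dist_eq, abs_lt]
      constructor <;> linarith [hτI.1, hτI.2, (le_max_left _ _ : t - s - ε / 2 ≤ a)]
    have h3 := hεball h2
    have h4 : ‖U s t y‖ ^ 2 ≤ ‖U s (s + τ) y‖ ^ 2 := pow_le_pow_left₀ (norm_nonneg _) h1 2
    linarith
  have hne : NeBot (ae (volume.restrict (Ioo a (t - s)))) := by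
    rw [ae_neBot, Ne, Measure.restrict_eq_zero, Real.volume_Ioo]
    exact (ENNReal.ofReal_pos.2 (by linarith)).ne'
  obtain ⟨τ, hτ⟩ := hfalse.exists
  exact hτ

/-! ## §2 The cell member: the orbit of a rest datum stays off the slow ball -/

section Cell

variable {k : ℕ} {W : LatticeWord k} {M : ℝ} {hM : 0 < M} {lo hi Λ ν ν₀ : ℝ} {n : ℕ} {𝔸 : Visc4 (Fin 3)} {Tw : ℝ}
  {U : ℝ → ℝ → (V2 →L[ℝ] V2)}

/-- **The orbit of a rest datum stays off the slow ball.**  A datum vanishing on `freqBall(n/4)` and on every class pair `±ℓ + nℤ³`,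
`ℓ ∈ freqBall(n/4) ∖ {0}`, keeps both along the cell member; in particular `U s r w` vanishes on `freqBall(n/4)`. -/
theorem orbit_off_ball_of_rest (hlo : 0 < lo) (hν : ν ∈ Set.Ioo 0 ν₀) (hn : 1 ≤ n)
    (hwin : ∃ lam ∈ Set.Icc (1:ℝ) Λ, NearIso 𝔸 (ν * (lo / lam)) (ν * (hi * lam)))
    (hU : IsPropagator Tw (cellField W M hM ν hν.1 n) ((1 / (n:ℝ) ^ 2) • 𝔸) U)
    (w : V2) (hw0 : ∀ k' ∈ FunctionSpaces.Torus.freqBall (d := Fin 3) (n / 4), fc w k' = 0)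
    (hwS : ∀ ℓ ∈ (FunctionSpaces.Torus.freqBall (d := Fin 3) (n / 4)).erase 0, ∀ k',
      ((∀ i, (n:ℤ) ∣ k' i - ℓ i) ∨ (∀ i, (n:ℤ) ∣ k' i + ℓ i)) → fc w k' = 0)
    {s r : ℝ} (hs : 0 ≤ s) (hsr : s ≤ r) (hrT : r ≤ Tw) :
    ∀ k' ∈ FunctionSpaces.Torus.freqBall (d := Fin 3) (n / 4), fc (U s r w) k' = 0 := by
  have hnpos : 0 < n := hn
  have hn0 : (0:ℝ) < n := by exact_mod_cast hnpos
  have hn2 : (0:ℝ) < 1 / (n:ℝ) ^ 2 := by positivity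
  obtain ⟨lam, hlam, hA𝔸⟩ := hwin
  have hlam0 : 0 < lam := by linarith [hlam.1]
  have hcell : NearIso ((1 / (n:ℝ) ^ 2) • 𝔸) ((1 / (n:ℝ) ^ 2) * (ν * (lo / lam))) ((1 / (n:ℝ) ^ 2) * (ν * (hi * lam))) :=
    hA𝔸.smul hn2.le
  have hcell_lo : 0 < (1 / (n:ℝ) ^ 2) * (ν * (lo / lam)) := mul_pos hn2 (mul_pos hν.1 (div_pos hlo hlam0))
  have hbU : MemLp (FunctionSpaces.Torus.stLift (cellField W M hM ν hν.1 n)) ∞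
      (volume.restrict (Ioo 0 Tw ×ˢ (univ : Set (EuclideanSpace ℝ (Fin 3))))) := memLp_top_stLift_cell _ n Tw
  have hbUdiv : ∀ᵐ τ ∂(volume.restrict (Ioo (0:ℝ) Tw)), FunctionSpaces.Torus.IsWeaklyDivFree (cellField W M hM ν hν.1 n τ) :=
    ae_of_all _ fun τ => (isDivFree_cell _ n τ).isWeaklyDivFree_holds (isSmooth_cell _ n τ)
  have hgrid : ∀ (j : Fin 3 → Fin n) (τ : ℝ) (y : UnitAddTorus (Fin 3)),
      cellField W M hM ν hν.1 n τ (y + (fun i => ((((j i : ℕ) : ℝ) / n : ℝ) : UnitAddCircle))) = cellField W M hM ν hν.1 n τ y :=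
    fun j τ y => by unfold cellField; exact cell_add_grid _ hnpos j τ y
  intro k' hk'
  by_cases hk0 : k' = 0
  · subst hk0
    rw [fc_apply_zero_eq hcell hcell_lo hbU hbUdiv hU hs hsr hrT w]
    exact hw0 0 hk'
  · have hk'S : k' ∈ (FunctionSpaces.Torus.freqBall (d := Fin 3) (n / 4)).erase 0 := Finset.mem_erase.2 ⟨hk0, hk'⟩
    exact PropagatorSymm.fcoeff_apply_eq_zero_of_classes hU hcell hcell_lo hbU hbUdiv hnpos hgrid k' hs hsr hrT w (hwS k' hk'S) k'
      (Or.inl fun i => by simp)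

set_option maxHeartbeats 1600000 in
/-- **DECAY OF THE CELL MEMBER ON A REST DATUM.**  For a weakly divergence-free `w` vanishing on `freqBall(n/4)` and on every class pair of a
nonzero slow label: `‖U s t w‖ ≤ exp(−(4π²·ν·(lo/Λ)·(n/4)²/n²)·(t−s))·‖w‖`. -/
theorem norm_apply_rest_le (hlo : 0 < lo) (hhi : 0 ≤ hi) (hΛ : 1 ≤ Λ) (hν : ν ∈ Set.Ioo 0 ν₀) (hn : 1 ≤ n)
    (hwin : ∃ lam ∈ Set.Icc (1:ℝ) Λ, NearIso 𝔸 (ν * (lo / lam)) (ν * (hi * lam)))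
    (hU : IsPropagator Tw (cellField W M hM ν hν.1 n) ((1 / (n:ℝ) ^ 2) • 𝔸) U)
    (w : V2) (hw : w ∈ divFreeL2 (Fin 3)) (hw0 : ∀ k' ∈ FunctionSpaces.Torus.freqBall (d := Fin 3) (n / 4), fc w k' = 0)
    (hwS : ∀ ℓ ∈ (FunctionSpaces.Torus.freqBall (d := Fin 3) (n / 4)).erase 0, ∀ k',
      ((∀ i, (n:ℤ) ∣ k' i - ℓ i) ∨ (∀ i, (n:ℤ) ∣ k' i + ℓ i)) → fc w k' = 0)
    {s t : ℝ} (hs : 0 ≤ s) (hst : s ≤ t) (htT : t ≤ Tw) :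
    ‖U s t w‖ ≤ Real.exp (-(4 * Real.pi ^ 2 * (ν * (lo / Λ)) * (((n / 4 : ℕ) : ℝ)) ^ 2 / (n:ℝ) ^ 2 * (t - s))) * ‖w‖ := by
  have hnpos : 0 < n := hn
  have hn0 : (0:ℝ) < n := by exact_mod_cast hnpos
  have hn2 : (0:ℝ) < 1 / (n:ℝ) ^ 2 := by positivity
  have hΛ0 : 0 < Λ := lt_of_lt_of_le one_pos hΛ
  have hAΛ : NearIso 𝔸 (ν * (lo / Λ)) (ν * (hi * Λ)) := by
    obtain ⟨lam, hlam, hA⟩ := hwin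
    have hlam1 : 0 < lam := lt_of_lt_of_le one_pos hlam.1
    exact hA.mono (mul_le_mul_of_nonneg_left (div_le_div_of_nonneg_left hlo.le hlam1 hlam.2) hν.1.le)
      (mul_le_mul_of_nonneg_left (mul_le_mul_of_nonneg_left hlam.2 hhi) hν.1.le)
  have hcell : NearIso ((1 / (n:ℝ) ^ 2) • 𝔸) ((1 / (n:ℝ) ^ 2) * (ν * (lo / Λ))) ((1 / (n:ℝ) ^ 2) * (ν * (hi * Λ))) := hAΛ.smul hn2.le
  have hcell_lo : 0 < (1 / (n:ℝ) ^ 2) * (ν * (lo / Λ)) := mul_pos hn2 (mul_pos hν.1 (div_pos hlo hΛ0))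
  have hbU : MemLp (FunctionSpaces.Torus.stLift (cellField W M hM ν hν.1 n)) ∞
      (volume.restrict (Ioo 0 Tw ×ˢ (univ : Set (EuclideanSpace ℝ (Fin 3))))) := memLp_top_stLift_cell _ n Tw
  have hbUdiv : ∀ᵐ τ ∂(volume.restrict (Ioo (0:ℝ) Tw)), FunctionSpaces.Torus.IsWeaklyDivFree (cellField W M hM ν hν.1 n τ) :=
    ae_of_all _ fun τ => (isDivFree_cell _ n τ).isWeaklyDivFree_holds (isSmooth_cell _ n τ)
  have horbit : ∀ r, s ≤ r → r ≤ Tw → ∀ k' ∈ FunctionSpaces.Torus.freqBall (d := Fin 3) (n / 4), fc (U s r w) k' = 0 :=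
    fun r hsr hrT => orbit_off_ball_of_rest hlo hν hn hwin hU w hw0 hwS hs hsr hrT
  have h := norm_sq_apply_le_exp_of_orbit_off_ball hU hcell hcell_lo hbU hbUdiv (n / 4) w hw hs hst htT horbit
  set E : ℝ := 4 * Real.pi ^ 2 * (ν * (lo / Λ)) * (((n / 4 : ℕ) : ℝ)) ^ 2 / (n:ℝ) ^ 2 * (t - s) with hE
  have hexp : Real.exp (-(8 * Real.pi ^ 2 * (1 / (n:ℝ) ^ 2 * (ν * (lo / Λ))) * (((n / 4 : ℕ) : ℝ)) ^ 2 * (t - s)))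
      = Real.exp (-E) ^ 2 := by
    rw [← Real.exp_nat_mul, hE]; congr 1; push_cast; field_simp; ring
  rw [hexp, ← mul_pow] at h
  exact (pow_le_pow_iff_left₀ (norm_nonneg _) (mul_nonneg (Real.exp_pos _).le (norm_nonneg _)) two_ne_zero).1 h

end Cell

end Summit.AnomalousDissipation.AnomalousDissipation.Theorems.SolenoidalFractalHomogenisation.LagrangianStep.VmodGen

end
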